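import Summits.QuantumFields.YangMills.Theorems.UnitScaleTiltHistoryTailLaneTailV4Chi
import Summits.QuantumFields.YangMills.Theorems.CoarseStiffnessTailCappedCoarseStiffnessLUnitPolyTailOfCount
import HarnessLib

/-!
# Route `CoarseStiffnessTail` — THE RATE-FREE TOP-SLICE SUPPLIER, file 3: S1_poly IS DOWNSTREAM OF THE OWNER'S χ-LANE — the (α)-record socket
# `IntCoreRecRows` (hence v5p10's single stub `AlphaInputsT3ACv4RecChi`) gives the per-plaquette large-field tail with VOLUME-FREE constants, and
# therefore S1_poly (lead's certificate, seat `ym-line-cst-p1` g22; helper on crux stmt-QuantumFields-25301)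

WHAT.  `HistoryTailLaneTailIntRows.perPlaquetteHigh_int` (width seat ym-ust-19936-w3 g5; the tail chain of crux stmt-QuantumFields-19936's line v5p10)
delivers, from a constants record `𝔠` and per-`(F, γ)` data cores with the interior (47)′ row, the per-plaquette tail
`Gibbs_K{θ(K−j) ≤ |Ū^{j}(∂p) − 1|} ≤ C·β^A·exp(−c·p(g)² + κ·x^{2+3r₀})` with `(j₀, A) = (0, 0)` and `C = max 1 C_Rm`, where `C_Rm = sup e^{2Rm}` bounds
the remainder factor of the (41) sandwich — EXTENSIVE IN THE PHYSICAL VOLUME (`RmSize`: `Rm ≤ r⋆γ^{3+κ₀}·Σ_{i<j} L^{−κ₀(K−i)}·(2L^m)³`) and kept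
OUTSIDE the chessboard root (`root_bound`).  §1 `perPlaquetteHigh_int_uniform` is the SAME proof with the one change that makes the constant
volume-free: `e^{2Rm}` goes UNDER the `|S|`-th root (`2Rm ≤ CR·x·N³`, `CR = 2r⋆(1 − L^{−κ₀})⁻¹`, `(2L^m)³ ≤ N³ = (sites per direction at level j)³ ≤
|S|·8(L(ρ+4))³`), so the conclusion holds with `C = 1`, `A = 0`, `j₀ = 0` and `κ` enlarged by `8·CR·L³(ccol+4)³` — constants depending on `(L, 𝔠)` ONLY.
§2 `unitPolyTail_of_intCoreRecRows` : the record-free interior socket at every odd `L > 1` ⇒ S1_poly (top slice `j = K ≥ 1` of §1 + `budget_of_c`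
(`2p₀ = 4r₀ + 2 > 2 + 3r₀`) + `exp_neg_pFun_sq_le_pow`; the cut-off `K = 0` is the bare torus, `bare_uniformLargeFieldCount_clean` + the top-slice
chessboard `perPlaquetteTop_of_countTop`); `unitPolyTail_of_laneRecordsV4Chi` : v5p10's stub `AlphaInputsT3ACv4RecChi` (∀ odd `L > 1`) ⇒ S1_poly;
(composed with file 1's `historyTailL_of_unitPolyTail` this re-proves the owner's `historyTailL_of_laneRecordsV4Chi` THROUGH the rate-free
statement; not restated here).

Kernel partial order (files 1–3): `{25301 ⇒ S1_top ⇒ S1_log} ⇒ S1_poly ⇐ {AlphaInputsT3ACv4RecChi ∀ L (v5p10's stub) ⇒ IntCoreRecRows ∀ L}`,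
`S1_poly ⇒ {HistoryTailL (19936), WedgeTailL (27959)}`.  READING (planners/director): S1_poly is the MEET of this line and the owner's χ-lane —
re-typed «25301 := S1_poly» closes with v5p10's single stub (no separate siege) and keeps this route's reflection-positivity entry as an alternative.

HONEST FRAMING.  Bookkeeping twin of `perPlaquetteHigh_int` (one estimate moved under a root; nothing of [Balaban1985UV3] or [Balaban1985Variational]
is proved); CONDITIONAL on the (α)-record hypotheses exactly as the original; S1_poly, `IntCoreRecRows`, `AlphaInputsT3ACv4RecChi`, 25301, 19936 stay
OPEN.  `YM3TorusSU2` is rung R3, a RECORD rung, NOT the Clay statement; the Yang–Mills mass gap is not touched.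

References: [Balaban1985UV3] T. Bałaban, CMP **102** (1985) 255–275 ((5), (41), (47), (71)); [Balaban1985Variational] ibid. 277–309 (Thm 1 (8));
[FrohlichIsraelLiebSimon1978] J. Fröhlich, R. Israel, E. Lieb, B. Simon, CMP **62** (1978) 1–34 (Thm 4.1).
-/
set_option autoImplicit false

noncomputable section

open MeasureTheory
open Literature.MathematicalPhysics.QuantumFieldTheory.Balaban1983to89
open Literature.MathematicalPhysics.QuantumFieldTheory.Balaban1983to89.T3ContinuumYM3Torus
open Literature.MathematicalPhysics.QuantumFieldTheory.Balaban1983to89.T3UnitScaleTilt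
open Literature.MathematicalPhysics.QuantumFieldTheory.Balaban1983to89.T3UnitLawDensityEML
open Literature.MathematicalPhysics.QuantumFieldTheory.Balaban1983to89.T3BareTailProfile
open Literature.MathematicalPhysics.QuantumFieldTheory.Balaban1983to89.T3ThresholdSmallness (sqrt_coupling_pos_le)
open Literature.MathematicalPhysics.QuantumFieldTheory.Balaban1983to89.T3Thresholds (coupling_le_one)
open Literature.MathematicalPhysics.QuantumFieldTheory.Balaban1983to89.T3AlphaInputsAC
open Literature.MathematicalPhysics.QuantumFieldTheory.Balaban1983to89.T3AlphaInputsACSchemas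
open Literature.MathematicalPhysics.QuantumFieldTheory.Balaban1983to89.B10Eq38TorusDomains (toFine)
open Literature.MathematicalPhysics.QuantumFieldTheory.Balaban1983to89.T3RestrictedUnitDensity (resDensity integrable_resDensity)
open Literature.MathematicalPhysics.QuantumFieldTheory.Balaban1983to89.Missing (partitionFn measurable_plaqHol)
open Summit.QuantumFields.Balaban3D.Carriers (suGroupModel)
open Summit.QuantumFields.Balaban3D.Proofs.Primitives (AlphaConsts)
open Summit.QuantumFields.Balaban3D.Proofs.Run3SmallFactors (regionT src_mem_plaqCover_of_mem_regionT)
open Summit.QuantumFields.YangMills.Theorems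
open Summit.QuantumFields.YangMills.Theorems.HistoryTailDensityTransfer (gibbsK_real_preimage_iter_eq)
open Summit.QuantumFields.YangMills.Theorems.HistoryTailSandwich (partitionFn_eq_integral_resDensity)
open Summit.QuantumFields.YangMills.Theorems.HistoryTailMechanismA (integral_mul_indicator_one_eq_setIntegral)
open Summit.QuantumFields.YangMills.Theorems.HistoryTailAlphaConsumer (setIntegral_div_integral_le_ae)
open Summit.QuantumFields.YangMills.Theorems.HistoryTailLaneRowsInt (laneRows_intRows windowedWeights_int_v5p5ShapeRows)
open Summit.QuantumFields.YangMills.Theorems.HistoryTailLaneNumeratorIntRows (setIntegral_up_le)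
open Summit.QuantumFields.YangMills.Theorems.HistoryTailLaneNumerator (gibbsK_real_iInter_le root_bound exponent_bound xlog_mono mass_budget budget_of_c)
open Summit.QuantumFields.YangMills.Theorems.HistoryTailLaneTailV4Chi (intCoreRecRows_of_laneRecordsV4Chi)
open Summit.QuantumFields.YangMills.Theorems.CoarseStiffnessTailBareUniformCount (bare_uniformLargeFieldCount_clean)
open Summit.QuantumFields.YangMills.Theorems.CoarseStiffnessTailUnitPolyTailOfCount (perPlaquetteTop_of_countTop exp_neg_pFun_sq_le_pow)

namespace Summit.QuantumFields.YangMills.Theorems.CoarseStiffnessTailUnitPolyTailOfChi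

open Classical

/-! ## §1 The per-plaquette tail of the (α)-record chain with VOLUME-FREE constants -/

/-- The geometric sum of `RmSize` is bounded uniformly in the cut-off: `Σ_{i<j} q^{K−i} ≤ 1/(1 − q)` (`j ≤ K`, `0 ≤ q < 1`; the tree's
private `T3AlphaInputsAC.geom_sum_le`, restated). [folklore] -/
theorem geom_sum_range_le {q : ℝ} (hq0 : 0 ≤ q) (hq1 : q < 1) {K j : ℕ} (hj : j ≤ K) :
    ∑ i ∈ Finset.range j, q ^ (K - i) ≤ (1 - q)⁻¹ := by
  have hle : ∀ i ∈ Finset.range j, q ^ (K - i) ≤ q ^ (j - 1 - i) := by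
    intro i hi
    have hij := Finset.mem_range.mp hi
    exact pow_le_pow_of_le_one hq0 hq1.le (by omega)
  calc ∑ i ∈ Finset.range j, q ^ (K - i) ≤ ∑ i ∈ Finset.range j, q ^ (j - 1 - i) := Finset.sum_le_sum hle
    _ = ∑ i ∈ Finset.range j, q ^ i := Finset.sum_range_reflect (fun i => q ^ i) j
    _ ≤ (1 - q)⁻¹ :=
        sum_le_hasSum (Finset.range j) (fun n _ => pow_nonneg hq0 n) (hasSum_geometric_of_lt_one hq0 hq1)

set_option maxHeartbeats 400000 in
/-- ★★ **THE PER-PLAQUETTE HIGH TAIL FROM THE INTERIOR (α)-RECORD SOCKET, VOLUME-FREE CONSTANTS** — `HistoryTailLaneTailIntRows.perPlaquetteHigh_int`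
verbatim (same hypotheses, same chain: 2″ `laneRows_intRows`, 2‴ `windowedWeights_int_v5p5ShapeRows`, 4c, 4a, 4b, the landed chessboard, Mechanism A,
the `|S|`-th root, the exponent algebra) with ONE change: the remainder factor `e^{2Rm^{(K)}_j}` of the (41) sandwich is put UNDER the `|S|`-th root
(`2Rm ≤ CR·x·N³`, `CR = 2r⋆(1 − L^{−κ₀})⁻¹`, from `dataIntRows_rmSize` and `(2L^m)³ ≤ N³`), so that the conclusion holds for EVERY height `1 ≤ j ≤ K`
with prefactor `1` and `κ := 8(CM + CP + CT + CL + 1 + CR)L³(ccol + 4)³` — all constants depend on `(L, 𝔠)` only, not on the family or the coupling.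
[cite: Balaban1985UV3, (5) p.256, (41) p.266, (47) p.267 and (71) p.273] -/
theorem perPlaquetteHigh_int_uniform (L : ℕ) (hLo : Odd L) (hL : 1 < L) (𝔠 : AlphaConsts L (suGroupModel 2).N) (a₁ : ℝ) (ha1 : 0 < a₁)
    (h𝔠 : ∀ (F : T3Family) (hF : F.L = L) (γ : ℝ) (hγ : 0 < γ) (hγ1 : γ ≤ (min (hF ▸ 𝔠).gamma0 1) ^ 2),
      ∃ qf : ∀ K, AlphaInputsT3AC.PkgCoreRows F (hF ▸ 𝔠) γ hγ hγ1 K, (∀ K, (qf K).a₁ = a₁) ∧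
        ((∀ i, θBal F.L γ (hF ▸ 𝔠).b₀ (hF ▸ 𝔠).p₀ i ≤ a₁) →
          ∀ (π : AlphaInputsT3AC.PolymerT3 F) (K j : ℕ), j ≤ K → Ineq47AE (AlphaInputsT3AC.dataIntRows qf π) K j)) :
    ∃ κ γ₁ c : ℝ, 0 ≤ κ ∧ 0 < γ₁ ∧ γ₁ ≤ 1 ∧ 0 < c ∧ c ≤ 1 / 4 ∧
      ∀ (F : T3Family) (γ : ℝ), F.L = L → 0 < γ → γ ≤ γ₁ →
          ∀ (K j : ℕ), 1 ≤ j → j ≤ K → ∀ p : Plaq (F.P K) j,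
            (gibbsK F ℰp γ K).real
                {U | θBal F.L γ 𝔠.b₀ 𝔠.p₀ (K - j) ≤
                  GaugeGroup.dist1 (GaugeField.plaqHol
                    (Averaging.iter (fun _ => BlockAveraging.blockAvg ℰp) j U) p)} ≤
                Real.exp (-(c * B10.pFun 𝔠.b₀ 𝔠.p₀ (Real.sqrt (γ * ((F.L : ℝ)⁻¹) ^ (K - j))) ^ 2) +
                  κ * (1 + Real.log (Real.sqrt (γ * ((F.L : ℝ)⁻¹) ^ (K - j)))⁻¹) ^ (2 + 3 * 𝔠.r₀)) := by
  -- the constants, all fixed with the record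
  obtain ⟨γ₂, cSF, CP, κZ, hγ₂, hcSF0, hcSF4, hCP, hκZ, hLane⟩ := laneRows_intRows L hLo hL 𝔠
  obtain ⟨γw, Bm, hγw, hBm, hWin⟩ := windowedWeights_int_v5p5ShapeRows L hLo hL 𝔠
  have hCT : (0 : ℝ) ≤ Bm := hBm
  set CT : ℝ := Bm with hCTdef
  obtain ⟨ccol, γc, hccol, hγc, h4c⟩ := Summit.QuantumFields.YangMills.Theorems.HistoryTailDiluteExponentIntRows.diluteExponent_of_smallFactorIn L hLo hL 𝔠 cSF hcSF0 hcSF4 κZ hκZ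
  obtain ⟨CM, γa, hCM, hγa, h4a⟩ :=
    Summit.QuantumFields.YangMills.Theorems.HistoryTailHistoryMassWIntRows.historyMassBound_of_weights_c L hLo hL 𝔠 CP hCP Bm hBm
      (cSF * 𝔠.b₀ ^ 2 / 50) (by have := 𝔠.b₀_pos; positivity)
  obtain ⟨CL, γb, hCL, hγb, h4b⟩ := Summit.QuantumFields.YangMills.Theorems.HistoryTailLowMassIntRows.lowMass_int_of_one_lt L hLo hL 𝔠 a₁ ha1 CP hCP
  obtain ⟨γθ, hγθ, hγθ1, hθle⟩ := T3Thresholds.exists_gamma_forall_θBal_le 𝔠.b₀_pos 𝔠.p₀_pos one_pos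
  obtain ⟨γA, hγA, hγA1, hθA⟩ := T3Thresholds.exists_gamma_forall_θBal_le 𝔠.b₀_pos 𝔠.p₀_pos ha1
  have hg0 : 0 < (min 𝔠.gamma0 1) ^ 2 := by have := 𝔠.gamma0_pos; positivity
  -- the remainder constant, VOLUME-FREE: `2·Rm^{(K)}_j ≤ CR·N_j³` with `CR = 2·r⋆·(1 − L^{−κ₀})⁻¹` (see `hRm` below)
  have hLR1 : (1 : ℝ) < (L : ℝ) := by exact_mod_cast hL
  have hLi0 : (0 : ℝ) ≤ (L : ℝ)⁻¹ := inv_nonneg.mpr (zero_lt_one.trans hLR1).le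
  set qR : ℝ := ((L : ℝ)⁻¹) ^ 𝔠.κ₀ with hqRdef
  have hqR0 : 0 ≤ qR := Real.rpow_nonneg hLi0 _
  have hqR1 : qR < 1 := Real.rpow_lt_one hLi0 (inv_lt_one_of_one_lt₀ hLR1) 𝔠.κ₀_pos
  set CR : ℝ := 2 * 𝔠.stepConsts.rstar * (1 - qR)⁻¹ with hCRdef
  have hCR0 : 0 ≤ CR := by
    rw [hCRdef]
    exact mul_nonneg (mul_nonneg (by norm_num) 𝔠.stepConsts.rstar_nonneg) (inv_nonneg.mpr (by linarith))
  set C : ℝ := CM + CP + CT + CL + 1 + CR with hCdef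
  have hC0 : 0 ≤ C := by rw [hCdef]; positivity
  have hL0 : (0 : ℝ) ≤ (L : ℝ) := by positivity
  refine ⟨8 * C * (L : ℝ) ^ 3 * (ccol + 4) ^ 3,
    min (min (min (min (min γ₂ γw) γc) (min γa γb)) (min (min γθ ((min 𝔠.gamma0 1) ^ 2)) 1)) γA, cSF, by positivity,
    by positivity, ((min_le_left _ _).trans (min_le_right _ _)).trans (min_le_right _ _), hcSF0, hcSF4,
    fun F γ hFL hγ hle' K j hj hjK p => ?_⟩
  have hle : γ ≤ min (min (min (min γ₂ γw) γc) (min γa γb)) (min (min γθ ((min 𝔠.gamma0 1) ^ 2)) 1) := hle'.trans (min_le_left _ _)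
  have hleA : γ ≤ γA := hle'.trans (min_le_right _ _)
  -- thresholds unpacked
  have hle2 : γ ≤ γ₂ := hle.trans ((min_le_left _ _).trans ((min_le_left _ _).trans ((min_le_left _ _).trans (min_le_left _ _))))
  have hlew : γ ≤ γw := hle.trans ((min_le_left _ _).trans ((min_le_left _ _).trans ((min_le_left _ _).trans (min_le_right _ _))))
  have hlec : γ ≤ γc := hle.trans ((min_le_left _ _).trans ((min_le_left _ _).trans (min_le_right _ _)))
  have hlea : γ ≤ γa := hle.trans ((min_le_left _ _).trans ((min_le_right _ _).trans (min_le_left _ _)))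
  have hleb : γ ≤ γb := hle.trans ((min_le_left _ _).trans ((min_le_right _ _).trans (min_le_right _ _)))
  have hleθ : γ ≤ γθ := hle.trans ((min_le_right _ _).trans ((min_le_left _ _).trans (min_le_left _ _)))
  have hleg : γ ≤ (min 𝔠.gamma0 1) ^ 2 := hle.trans ((min_le_right _ _).trans ((min_le_left _ _).trans (min_le_right _ _)))
  have hγ1 : γ ≤ 1 := hle.trans ((min_le_right _ _).trans (min_le_right _ _))
  subst hFL
  have hL1 : 1 ≤ F.L := F.hL.2.le
  -- the family of data cores of this family, and the interior datum
  obtain ⟨qf, hqa, h47⟩ := h𝔠 F rfl γ hγ hleg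
  have hθa : ∀ i, θBal F.L γ 𝔠.b₀ 𝔠.p₀ i ≤ a₁ := fun i => hθA F.L hL1 γ hγ hleA i
  let π : AlphaInputsT3AC.PolymerT3 F := ⟨fun _ _ _ _ => ∅, fun _ _ _ _ => 0, fun _ _ Y => Y, fun _ _ _ => 0⟩
  obtain ⟨hSF, hPS, hZ⟩ := hLane F rfl γ hγ hleg qf π hle2
  obtain ⟨wt', hw0, hwz, hwAdm, hwI, hPm, h41I⟩ := hWin F rfl γ hγ hleg qf π hlew
  have hExp := h4c F rfl γ hγ hleg qf π hlec hSF hZ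
  have hMass := h4a F rfl γ hγ hleg qf π (fun K j r _ Wf => wt' K j r Wf) hlea (fun K j r _ Wf => hw0 K j r Wf)
    (fun K j r _ Wf hra => hwz K j r Wf hra) hPS (fun K j r _ hjK hne => hwAdm K j r hjK (Nat.one_le_iff_ne_zero.mpr fun hj0 => hne (by subst hj0; exact Summit.QuantumFields.Balaban3D.Carriers.Hist.eq_triv_zero r))) (fun K j r _ hjK => hwI K j r hjK)
    (fun K j r _ hjK => hPm K j r hjK)
  have hLow := h4b F rfl γ hγ hleg qf π hqa hleb hPS
  -- the datum with the windowed weights (regions, minimiser, main term, interaction, Zterm, χ, low, Rm unchanged)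
  let D' : AlphaDataT3 F γ := { AlphaInputsT3AC.dataIntRows qf π with
    LF := fun K j Wf Φ => wt' K j (Summit.QuantumFields.Balaban3D.Carriers.Hist.triv (F.P K) j) Wf *
        Real.exp (Φ (Summit.QuantumFields.Balaban3D.Carriers.Hist.triv (F.P K) j)) +
      ∑ r ∈ Finset.univ.erase (Summit.QuantumFields.Balaban3D.Carriers.Hist.triv (F.P K) j),
        wt' K j r Wf * Real.exp (Φ r) }
  have hRmSize := AlphaInputsT3AC.dataIntRows_rmSize qf π
  have hj1 : 1 ≤ j := hj
  -- names for the scale-`K−j` quantities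
  set g : ℝ := Real.sqrt (γ * ((F.L : ℝ)⁻¹) ^ (K - j)) with hg
  set x : ℝ := 1 + Real.log g⁻¹ with hx
  set θ : ℝ := θBal F.L γ 𝔠.b₀ 𝔠.p₀ (K - j) with hθ
  set N : ℝ := ((F.P K).sitesPerDir j : ℝ) with hN
  have hgpos : 0 < g := (sqrt_coupling_pos_le hL1 hγ (K - j)).1
  have hg1 : g ≤ 1 := coupling_le_one hL1 hγ hγ1 (K - j)
  have hx1 : 1 ≤ x := by
    have : 0 ≤ Real.log g⁻¹ := Real.log_nonneg (one_le_inv_iff₀.mpr ⟨hgpos, hg1⟩)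
    linarith
  have hr₀ : 0 ≤ 𝔠.r₀ := zero_le_one.trans 𝔠.one_le_r₀
  have hxr : 1 ≤ x ^ 𝔠.r₀ := Real.one_le_rpow hx1 hr₀
  have hN1 : 1 ≤ N := by
    rw [hN]; exact_mod_cast Nat.one_le_iff_ne_zero.mpr ((F.P K).sitesPerDir_ne_zero j)
  have hN3 : 1 ≤ N ^ 3 := one_le_pow₀ hN1
  have hxN : 1 ≤ x * N ^ 3 := one_le_mul_of_one_le_of_one_le hx1 hN3
  -- the chessboard family at separation `ρ = ccol·x^{r₀}`
  have hρ1 : 1 ≤ ccol * x ^ 𝔠.r₀ := one_le_mul_of_one_le_of_one_le hccol hxr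
  obtain ⟨S, hpS, hsep, hcount, hchess⟩ :=
    HistoryTailChessboardT3.chessboardRP_T3 F.L hLo hL F γ rfl hγ hγ1 θ K j hjK (ccol * x ^ 𝔠.r₀) hρ1 p
  have hcard : 1 ≤ S.card := Finset.card_pos.mpr ⟨p, hpS⟩
  -- the numerator bound: exponent (4c) + history mass (4a) + trivial mass (2″f) + minorant mass (4b)
  set P4 : ℝ := cSF * B10.pFun 𝔠.b₀ 𝔠.p₀ g ^ 2 with hP4
  set σ : ℕ → ℝ := fun i => cSF * 𝔠.b₀ ^ 2 / 50 *
      (1 + Real.log (Real.sqrt (γ * ((F.L : ℝ)⁻¹) ^ (K - i)))⁻¹) ^ (2 * 𝔠.p₀ - 1) *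
      ((1 + Real.log (Real.sqrt (γ * ((F.L : ℝ)⁻¹) ^ (K - i)))⁻¹) - (1 + Real.log (Real.sqrt (γ * ((F.L : ℝ)⁻¹) ^ (K - j)))⁻¹)) with hσdef
  have hσ0 : ∀ i, i < j → 0 ≤ σ i := by
    intro i hij
    have hxi : 1 ≤ 1 + Real.log (Real.sqrt (γ * ((F.L : ℝ)⁻¹) ^ (K - i)))⁻¹ := hx1.trans (xlog_mono F hγ hij.le)
    have h1 : 0 ≤ (1 + Real.log (Real.sqrt (γ * ((F.L : ℝ)⁻¹) ^ (K - i)))⁻¹) ^ (2 * 𝔠.p₀ - 1) :=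
      Real.rpow_nonneg (zero_le_one.trans hxi) _
    have h2 : 0 ≤ (1 + Real.log (Real.sqrt (γ * ((F.L : ℝ)⁻¹) ^ (K - i)))⁻¹) - (1 + Real.log (Real.sqrt (γ * ((F.L : ℝ)⁻¹) ^ (K - j)))⁻¹) :=
      sub_nonneg.mpr (xlog_mono F hγ hij.le)
    have hb : 0 ≤ cSF * 𝔠.b₀ ^ 2 / 50 := by have := hcSF0.le; positivity
    exact mul_nonneg (mul_nonneg hb h1) h2
  let v₀ : (i : Fin j) → GaugeField (F.P K) i (Matrix.specialUnitaryGroup (Fin 2) ℂ) := fun _ => 1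
  set Pz : ℝ := CP * θBal F.L γ 𝔠.b₀ 𝔠.p₀ (K - j + 1) ^ 2 * N ^ 3 with hPz
  have hθ1 : θBal F.L γ 𝔠.b₀ 𝔠.p₀ (K - j + 1) ≤ 1 := hθle F.L hL1 γ hγ hleθ (K - j + 1)
  have hθ0' : 0 ≤ θBal F.L γ 𝔠.b₀ 𝔠.p₀ (K - j + 1) :=
    (T3MinimiserStabilityReduction.θBal_pos hL1 hγ hγ1 𝔠.b₀_pos 𝔠.p₀ (K - j + 1)).le
  have hPzle : Pz ≤ CP * (x * N ^ 3) := by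
    have hsq : θBal F.L γ 𝔠.b₀ 𝔠.p₀ (K - j + 1) ^ 2 ≤ 1 := pow_le_one₀ hθ0' hθ1
    have hN30 : 0 ≤ N ^ 3 := zero_le_one.trans hN3
    calc Pz = CP * (θBal F.L γ 𝔠.b₀ 𝔠.p₀ (K - j + 1) ^ 2 * N ^ 3) := by rw [hPz]; ring
      _ ≤ CP * (1 * N ^ 3) := mul_le_mul_of_nonneg_left (mul_le_mul_of_nonneg_right hsq hN30) hCP
      _ ≤ CP * (x * N ^ 3) := mul_le_mul_of_nonneg_left (mul_le_mul_of_nonneg_right hx1 hN30) hCP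
  have h2le : Bm ≤ Real.exp (CT * x * N ^ 3) := by
    calc Bm ≤ Bm + 1 := by linarith
      _ ≤ Real.exp Bm := Real.add_one_le_exp Bm
      _ ≤ Real.exp (CT * x * N ^ 3) := Real.exp_le_exp.mpr (by rw [hCTdef]; nlinarith [hxN, hBm])
  have hnumer := setIntegral_up_le qf π K j S θ P4 (Real.exp (CM * x * N ^ 3)) (Real.exp (CT * x * N ^ 3)) Pz σ hσ0
    (fun r Wf => wt' K j r Wf) (fun r Wf => hw0 K j r Wf)
    (AlphaDataT3.up D' K j) (wt' K j (Summit.QuantumFields.Balaban3D.Carriers.Hist.triv (F.P K) j))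
    (fun Wf => hw0 K j _ Wf) (fun Wf => rfl)
    (fun r Wf hadm hWE => hExp K j hjK r v₀ Wf hadm S hWE hsep)
    (fun r _ => hwAdm K j r hjK hj1) (hwAdm K j _ hjK hj1)
    (fun r Wf hadm => (abs_le.mp (hPS K j r Wf hjK hj1 hadm)).2)
    (hMass K j hjK v₀) ⟨(hwI K j _ hjK).1, (hwI K j _ hjK).2.trans h2le⟩
    (h41I K j hjK).2
  -- the bound `B` against `∫ low`
  have hlowmass : Real.exp (-(CL * x * N ^ 3)) ≤
      ∫ Wf, (AlphaInputsT3AC.dataIntRows qf π).low K j Wf ∂fieldMeasure (F.P K) j (Matrix.specialUnitaryGroup (Fin 2) ℂ) := hLow K j hjK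
  have hB := mass_budget (c := (S.card : ℝ) * P4) hCM hCP hCT hxN hPzle hlowmass
  have hnum := hnumer.trans hB
  -- Mechanism A on the joint event from the DELIVERED envelopes
  have h47' : Ineq47AE D' K j := h47 hθa π K j hjK
  have hreg' : EnvelopeRegular D' K j :=
    ⟨AlphaInputsT3AC.dataIntRows_integrable_low qf π K j hjK, (h41I K j hjK).2, AlphaInputsT3AC.dataIntRows_integral_low_pos qf π K j hjK⟩
  have hinter := gibbsK_real_iInter_le (D := D') hγ.le hjK (h41I K j hjK).1 h47' hreg'
    (fun Wf => T3AlphaInputsAC.low_nonneg (AlphaInputsT3AC.dataIntRows_chiRange qf π) K j Wf) S θ _ hnum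
  -- the remainder factor `e^{2Rm}` goes UNDER the root: `2·Rm^{(K)}_j ≤ CR·x·N³` (extensive in the physical volume `(2L^m)³ ≤ N³`)
  have hRm : 2 * (AlphaInputsT3AC.dataIntRows qf π).Rm K j ≤ CR * x * N ^ 3 := by
    obtain ⟨hq0, hq1, hRK⟩ := hRmSize
    have hgeom := geom_sum_range_le hq0 hq1 hjK
    have hγpow : γ ^ (3 + 𝔠.κ₀) ≤ 1 :=
      Real.rpow_le_one hγ.le hγ1 (by have := 𝔠.κ₀_pos; positivity)
    have hvol : (2 * (F.L : ℝ) ^ F.m) ^ 3 ≤ N ^ 3 := by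
      have hN' : (2 * (F.L : ℝ) ^ F.m) ≤ N := by
        rw [hN, F.P_eq_PP, F.sitesPerDir_PP]
        push_cast
        have hL1R : (1 : ℝ) ≤ (F.L : ℝ) := by exact_mod_cast hL1
        exact mul_le_mul_of_nonneg_left (pow_le_pow_right₀ hL1R (by omega)) (by norm_num)
      exact pow_le_pow_left₀ (by positivity) hN' 3
    have hS0 : 0 ≤ ∑ i ∈ Finset.range j, qR ^ (K - i) := Finset.sum_nonneg fun i _ => pow_nonneg hq0 _
    have hV0 : 0 ≤ (2 * (F.L : ℝ) ^ F.m) ^ 3 := by positivity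
    have hr0 : 0 ≤ 𝔠.stepConsts.rstar := 𝔠.stepConsts.rstar_nonneg
    have h1q : 0 < 1 - qR := sub_pos.mpr hq1
    have hN30 : 0 ≤ N ^ 3 := zero_le_one.trans hN3
    have step1 : 𝔠.stepConsts.rstar * γ ^ (3 + 𝔠.κ₀) ≤ 𝔠.stepConsts.rstar := by
      have := mul_le_mul_of_nonneg_left hγpow hr0
      rwa [mul_one] at this
    have step2 : 𝔠.stepConsts.rstar * γ ^ (3 + 𝔠.κ₀) * (∑ i ∈ Finset.range j, qR ^ (K - i)) ≤
        𝔠.stepConsts.rstar * (1 - qR)⁻¹ := mul_le_mul step1 hgeom hS0 hr0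
    have step3 : 𝔠.stepConsts.rstar * γ ^ (3 + 𝔠.κ₀) * (∑ i ∈ Finset.range j, qR ^ (K - i)) * (2 * (F.L : ℝ) ^ F.m) ^ 3 ≤
        𝔠.stepConsts.rstar * (1 - qR)⁻¹ * N ^ 3 := mul_le_mul step2 hvol hV0 (mul_nonneg hr0 (inv_nonneg.mpr h1q.le))
    have step4 : CR * N ^ 3 ≤ CR * x * N ^ 3 := by
      have := mul_le_mul_of_nonneg_right (mul_le_mul_of_nonneg_left hx1 hCR0) hN30
      rwa [mul_one] at this
    calc 2 * (AlphaInputsT3AC.dataIntRows qf π).Rm K j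
        ≤ 2 * (𝔠.stepConsts.rstar * γ ^ (3 + 𝔠.κ₀) * (∑ i ∈ Finset.range j, qR ^ (K - i)) * (2 * (F.L : ℝ) ^ F.m) ^ 3) :=
          mul_le_mul_of_nonneg_left (hRK K j hjK).2 (by norm_num)
      _ ≤ 2 * (𝔠.stepConsts.rstar * (1 - qR)⁻¹ * N ^ 3) := mul_le_mul_of_nonneg_left step3 (by norm_num)
      _ = CR * N ^ 3 := by rw [hCRdef]; ring
      _ ≤ CR * x * N ^ 3 := step4
  have hexpRm : Real.exp (2 * (AlphaInputsT3AC.dataIntRows qf π).Rm K j) ≤ Real.exp (CR * x * N ^ 3) := Real.exp_le_exp.mpr hRm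
  have hsum : CR * x * N ^ 3 + (-((S.card : ℝ) * P4) + (CM + CP + CT + CL + 1) * x * N ^ 3) =
      -P4 * (S.card : ℝ) + C * x * N ^ 3 := by rw [hCdef]; ring
  have h2 := hinter.trans (mul_le_mul_of_nonneg_right hexpRm (Real.exp_nonneg _))
  have hB2 : (gibbsK F ℰp γ K).real
        {U | ∀ q ∈ S, θ ≤ GaugeGroup.dist1 (GaugeField.plaqHol
          (Averaging.iter (fun _ => BlockAveraging.blockAvg ℰp) j U) q)} ≤
      1 * Real.exp (-P4 * (S.card : ℝ) + C * x * N ^ 3) :=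
    calc (gibbsK F ℰp γ K).real
          {U | ∀ q ∈ S, θ ≤ GaugeGroup.dist1 (GaugeField.plaqHol
            (Averaging.iter (fun _ => BlockAveraging.blockAvg ℰp) j U) q)}
        ≤ Real.exp (CR * x * N ^ 3) *
            Real.exp (-((S.card : ℝ) * P4) + (CM + CP + CT + CL + 1) * x * N ^ 3) := h2
      _ = Real.exp (CR * x * N ^ 3 + (-((S.card : ℝ) * P4) + (CM + CP + CT + CL + 1) * x * N ^ 3)) :=
          (Real.exp_add _ _).symm
      _ = Real.exp (-P4 * (S.card : ℝ) + C * x * N ^ 3) := congrArg Real.exp hsum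
      _ = 1 * Real.exp (-P4 * (S.card : ℝ) + C * x * N ^ 3) := (one_mul _).symm
  -- the root and the exponent
  have hroot := root_bound (E := -P4 * (S.card : ℝ) + C * x * N ^ 3) hcard measureReal_nonneg zero_le_one hchess hB2
  have hcount' : N ^ 3 ≤ (S.card : ℝ) * (8 * ((F.L : ℝ) * (ccol * x ^ 𝔠.r₀ + 4)) ^ 3) := by rw [hN]; exact hcount
  have hexp := exponent_bound (P4 := P4) (C := C) hcard hC0 hx1 hL0 hccol hr₀ hcount'
  have hmax : max (1 : ℝ) 1 = 1 := max_self 1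
  rw [hmax, one_mul] at hroot
  rw [hP4] at hexp
  exact hroot.trans (Real.exp_le_exp.mpr hexp)

/-! ## §2 The socket, hence v5p10's stub, implies S1_poly -/

/-- ★★★ **`IntCoreRecRows` AT EVERY ODD `L > 1` ⇒ S1_poly**: at the top slice `j = K ≥ 1`, §1 gives `P_top ≤ exp(−c·p(√γ)² + κ·x(√γ)^{2+3r₀})`
with `(κ, γ₁, c)` from the record; `budget_of_c` (`1 + 3r₀/2 < p₀ = 2r₀ + 1`) turns it into `C₆·e^{−c′p(√γ)²}` and `exp_neg_pFun_sq_le_pow` into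
`C₆·γ⁴` below a threshold; the cut-off `K = 0` (no averaging: the bare Wilson torus `(2L^m)³` at `β = γ⁻¹`) is `bare_uniformLargeFieldCount_clean`
(`c₀ = 1/24`, `C₀ = log 2`, uniform) through the top-slice chessboard `perPlaquetteTop_of_countTop`.  For `L` even or `≤ 1` there is no family and
the statement is vacuous.  Conditional on the socket; nothing of [Balaban1985UV3] is proved. [cite: Balaban1985UV3, (5) p.256, (47) p.267 and (71) p.273] -/
theorem unitPolyTail_of_intCoreRecRows (hrec : ∀ L : ℕ, Odd L → 1 < L → AlphaInputsT3AC.IntCoreRecRows L) :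
    ∀ (L : ℕ) (b₁ p₁ : ℝ), ∃ (b₀ p₀ : ℝ), b₁ ≤ b₀ ∧ p₁ ≤ p₀ ∧ 0 < b₀ ∧ 2 < p₀ ∧
      ∃ (s C γ₁ : ℝ), 3 < s ∧ 0 ≤ C ∧ 0 < γ₁ ∧ γ₁ ≤ 1 ∧
        ∀ (F : T3Family) (γ : ℝ), F.L = L → 0 < γ → γ ≤ γ₁ → ∀ (K : ℕ) (a : Plaq (F.P K) K),
          (T3UnitScaleTilt.gibbsK F T3UnitLawDensityEML.ℰp γ K).real
              {U | T3UnitScaleTilt.θBal F.L γ b₀ p₀ 0 ≤ GaugeGroup.dist1 (GaugeField.plaqHol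
                (Averaging.iter (fun i => BlockAveraging.blockAvg (P := F.P K) (j := i) T3UnitLawDensityEML.ℰp) K U) a)} ≤
            C * γ ^ s := by
  intro L b₁ p₁
  by_cases hLL : Odd L ∧ 1 < L
  swap
  · -- no family has this block size: vacuous
    refine ⟨max b₁ 1, max p₁ 3, le_max_left _ _, le_max_left _ _, lt_of_lt_of_le one_pos (le_max_right _ _),
      lt_of_lt_of_le (by norm_num) (le_max_right _ _), 4, 0, 1, by norm_num, le_rfl, one_pos, le_rfl,
      fun F γ hFL _ _ K a => absurd ?_ hLL⟩
    exact hFL ▸ F.hL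
  obtain ⟨hLo, hL⟩ := hLL
  obtain ⟨b₁', p₁', hrec'⟩ := hrec L hLo hL
  obtain ⟨𝔠, a₁, hcb, hcp, ha1, h𝔠⟩ := hrec' (max b₁ b₁') (max p₁ p₁') (le_max_right _ _) (le_max_right _ _)
  obtain ⟨κ, γ₁, c, hκ, hγ₁, hγ₁1, hc0, -, hhigh⟩ := perPlaquetteHigh_int_uniform L hLo hL 𝔠 a₁ ha1 h𝔠
  have hr₀ : 0 ≤ 𝔠.r₀ := zero_le_one.trans 𝔠.one_le_r₀
  have hp : 1 + 3 * 𝔠.r₀ / 2 < 𝔠.p₀ := by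
    have := 𝔠.one_le_r₀
    show 1 + 3 * 𝔠.r₀ / 2 < 2 * 𝔠.r₀ + 1
    linarith
  obtain ⟨C₆, c', hC₆, hc', hbud⟩ := budget_of_c 𝔠.b₀ 𝔠.p₀ 𝔠.r₀ κ c 𝔠.b₀_pos hr₀ hκ hp hc0
  have hp₀2 : (2 : ℝ) ≤ 𝔠.p₀ := 𝔠.two_lt_p₀.le
  obtain ⟨γ₀, hγ₀, -, hexp⟩ := exp_neg_pFun_sq_le_pow 𝔠.b₀_pos hp₀2 hc' 4
  -- the bare cut-off `K = 0`
  obtain ⟨γb, hγb, hγb1, hbare⟩ := bare_uniformLargeFieldCount_clean (p₀ := 𝔠.p₀) 𝔠.b₀_pos (by linarith)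
  obtain ⟨γ₀', hγ₀', -, hexp'⟩ := exp_neg_pFun_sq_le_pow 𝔠.b₀_pos hp₀2 (by norm_num : (0 : ℝ) < 1 / 24) 4
  refine ⟨𝔠.b₀, 𝔠.p₀, hcb ▸ le_max_left _ _, hcp ▸ le_max_left _ _, 𝔠.b₀_pos, 𝔠.two_lt_p₀, ((4 : ℕ) : ℝ),
    max C₆ (Real.exp (9000 * (L : ℝ) ^ 3 * |Real.log 2|)), min (min γ₁ γ₀) (min γb γ₀'), by norm_num,
    hC₆.trans (le_max_left _ _), lt_min (lt_min hγ₁ hγ₀) (lt_min hγb hγ₀'), ((min_le_left _ _).trans (min_le_left _ _)).trans hγ₁1,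
    fun F γ hFL hγ hγle K a => ?_⟩
  have hγγ₁ : γ ≤ γ₁ := hγle.trans ((min_le_left _ _).trans (min_le_left _ _))
  have hγγ₀ : γ ≤ γ₀ := hγle.trans ((min_le_left _ _).trans (min_le_right _ _))
  have hγγb : γ ≤ γb := hγle.trans ((min_le_right _ _).trans (min_le_left _ _))
  have hγγ₀' : γ ≤ γ₀' := hγle.trans ((min_le_right _ _).trans (min_le_right _ _))
  have hγ1 : γ ≤ 1 := hγγ₁.trans hγ₁1
  rw [Real.rpow_natCast]
  subst hFL
  rcases Nat.eq_zero_or_pos K with hK | hK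
  · -- `K = 0`: the bare torus
    subst hK
    have hN := hbare F γ hγ hγγb 0
    rw [pow_zero, mul_one] at hN
    have htop := perPlaquetteTop_of_countTop F hγ hγ1 (θ := θBal F.L γ 𝔠.b₀ 𝔠.p₀ 0)
      (t := (1 / 24) * B10.pFun 𝔠.b₀ 𝔠.p₀ (Real.sqrt γ) ^ 2) (C₁ := Real.log 2) (by positivity) 0 hN a
    refine htop.trans ?_
    have h1 : Real.exp (-((1 / 24) * B10.pFun 𝔠.b₀ 𝔠.p₀ (Real.sqrt γ) ^ 2)) ≤ γ ^ 4 := hexp' γ hγ hγγ₀'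
    calc Real.exp (9000 * (F.L : ℝ) ^ 3 * |Real.log 2|) * Real.exp (-((1 / 24) * B10.pFun 𝔠.b₀ 𝔠.p₀ (Real.sqrt γ) ^ 2))
        ≤ Real.exp (9000 * (F.L : ℝ) ^ 3 * |Real.log 2|) * γ ^ 4 := mul_le_mul_of_nonneg_left h1 (Real.exp_pos _).le
      _ ≤ max C₆ (Real.exp (9000 * (F.L : ℝ) ^ 3 * |Real.log 2|)) * γ ^ 4 :=
          mul_le_mul_of_nonneg_right (le_max_right _ _) (by positivity)
  · -- `K ≥ 1`: the top slice `j = K` of §1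
    have hh := hhigh F γ rfl hγ hγγ₁ K K hK le_rfl a
    rw [Nat.sub_self, pow_zero, mul_one] at hh
    have hg1 : Real.sqrt γ ≤ 1 := Real.sqrt_le_one.mpr hγ1
    have hgpos : 0 < Real.sqrt γ := Real.sqrt_pos.mpr hγ
    refine hh.trans ((hbud (Real.sqrt γ) hgpos hg1).trans ?_)
    calc C₆ * Real.exp (-(c' * B10.pFun 𝔠.b₀ 𝔠.p₀ (Real.sqrt γ) ^ 2)) ≤ C₆ * γ ^ 4 :=
          mul_le_mul_of_nonneg_left (hexp γ hγ hγγ₀) hC₆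
      _ ≤ max C₆ (Real.exp (9000 * (F.L : ℝ) ^ 3 * |Real.log 2|)) * γ ^ 4 :=
          mul_le_mul_of_nonneg_right (le_max_left _ _) (by positivity)

/-- ★★★ **v5p10's STUB ⇒ S1_poly**: `AlphaInputsT3ACv4RecChi L` for every odd `L > 1` (the χ-lane's version-4 END theorem, the single registered
stub `stub_laneRecordsV4Chi` of crux stmt-QuantumFields-19936's line v5p10) instantiates the socket (`intCoreRecRows_of_laneRecordsV4Chi`), hence
§2.  Conditional certificate; both sides OPEN. [cite: Balaban1985UV3, (5) p.256, (47) p.267 and (71) p.273; Balaban1985Variational, Thm 1 (8) p.279] -/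
theorem unitPolyTail_of_laneRecordsV4Chi
    (hrec : ∀ L : ℕ, Odd L → 1 < L → Summit.QuantumFields.YangMills.Theorems.AlphaInputsT3ACv4RecChi L) :
    ∀ (L : ℕ) (b₁ p₁ : ℝ), ∃ (b₀ p₀ : ℝ), b₁ ≤ b₀ ∧ p₁ ≤ p₀ ∧ 0 < b₀ ∧ 2 < p₀ ∧
      ∃ (s C γ₁ : ℝ), 3 < s ∧ 0 ≤ C ∧ 0 < γ₁ ∧ γ₁ ≤ 1 ∧
        ∀ (F : T3Family) (γ : ℝ), F.L = L → 0 < γ → γ ≤ γ₁ → ∀ (K : ℕ) (a : Plaq (F.P K) K),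
          (T3UnitScaleTilt.gibbsK F T3UnitLawDensityEML.ℰp γ K).real
              {U | T3UnitScaleTilt.θBal F.L γ b₀ p₀ 0 ≤ GaugeGroup.dist1 (GaugeField.plaqHol
                (Averaging.iter (fun i => BlockAveraging.blockAvg (P := F.P K) (j := i) T3UnitLawDensityEML.ℰp) K U) a)} ≤
            C * γ ^ s :=
  unitPolyTail_of_intCoreRecRows fun L hLo hL => intCoreRecRows_of_laneRecordsV4Chi L (hrec L hLo hL)


/-- **THE RUNG-R3 LEAF FROM THE TWO RESIDUAL CRUXES AND v5p10's STUB, ROUTED THROUGH S1_poly** (`UnitScaleTilt.closes` on file 1's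
`historyTailL_of_unitPolyTail ∘ unitPolyTail_of_laneRecordsV4Chi`): CONDITIONAL on three OPEN hypotheses; a RECORD rung, not Clay; recorded to show
that the re-typed route «25301 := S1_poly» needs nothing beyond the χ-lane's single stub. [cite: Balaban1985UV3, (5) p.256 and (71) p.273; King1986, (3.12) p.657] -/
theorem ym3TorusSU2_of_residuals_and_laneRecordsV4Chi_via_poly
    (h200 : Summit.QuantumFields.YangMills.Theses.UnitScaleTilt.MinimiserStabilityRegPr)
    (h201 : Summit.QuantumFields.YangMills.Theses.UnitScaleTilt.FluctuationComparisonRegPrIntL)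
    (hrec : ∀ L : ℕ, Odd L → 1 < L → Summit.QuantumFields.YangMills.Theorems.AlphaInputsT3ACv4RecChi L) :
    Literature.MathematicalPhysics.QuantumFieldTheory.Balaban1983to89.T3YM3TorusStatement.YM3TorusSU2 :=
  CoarseStiffnessTailUnitPolyTail.ym3TorusSU2_of_residuals_and_unitPolyTail h200 h201 (unitPolyTail_of_laneRecordsV4Chi hrec)

end Summit.QuantumFields.YangMills.Theorems.CoarseStiffnessTailUnitPolyTailOfChi

end
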